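import Mathlib.GroupTheory.SpecificGroups.Dihedral
import Summits.MatrixMultiplication.OmegaCensus.RingMetaCyclic
import Summits.MatrixMultiplication.OmegaCensus.MetaCyclic
import Summits.MatrixMultiplication.OmegaCensus.BoxKeyLiftModel

/-!
# ω-census, family (b3): the universal property of `R ⋊_u ℤ/n` (`RCyc`), its reductions, and the bridges to `MetaCyc` and `DihedralGroup`

HONEST FRAMING (pub-omega census; verbatim): lottery ticket; floor = certified bounds/negative ranges.
Census BOOKKEEPING (conjecture C9 of the cell, STRUCTURE.md §2; pub-omega kernel-l4 gen 17, task K-5″).  TOOLKIT for turning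
the cell's CONCRETE box-useless models (`DihedralGroup n`, `MetaCyc p 3 u`, `EisCyc p = RCyc (𝔽_p[ω]) 3 ω` — stpp-1's atom
lane) into RELATION-FORM theorems about an arbitrary finite group `G` (`BoxBadAtomsSmallQ`):
* `RCyc.lift` — the universal property of `RCyc R n u = R ⋊_u ℤ/n`: an additive character `e : Multiplicative R →* G` and an
  element `y` with `y^n = 1` and `y e(r) y⁻¹ = e(u r)` give a homomorphism `(r, t) ↦ e(r) y^t`; `RCyc.lift_injective` — it is
  injective as soon as `e` is and no non-trivial power `y^t` (`t ≠ 0 mod n`) lies in the image of `e`;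
  `RCyc.pow_orderOf_smul_eq` — with `e` injective, `u ^ orderOf y = 1` automatically.
* `RCyc.redHom` — the reduction `RCyc R n u →* RCyc R q u`, `t ↦ t mod q`, for `q ∣ n` and `u^q = 1` (surjective).
* `MetaCyc.toRCyc` — `MetaCyc N q u →* RCyc (ZMod N) q u` (the identity on coordinates; injective), and
  `DihedralGroup.toRCyc` — `DihedralGroup m →* RCyc (ZMod m) 2 (-1)`, `r i ↦ (i, 0)`, `sr i ↦ (−i, 1)` (injective).
Pure algebra; nothing here is progress on `ω`.
-/

namespace Summit.MatrixMultiplication.OmegaCensus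

open KeyLift

namespace RCyc

variable {R : Type*} [CommRing R] {n : ℕ} {u : R} [NeZero n] [hun : Fact (u ^ n = 1)]
variable {G : Type*} [Group G]

/-- Iterating the twist: `yᵏ e(r) y⁻ᵏ = e(uᵏ r)`. [folklore] -/
theorem conj_pow_smul (e : Multiplicative R →* G) (y : G)
    (hy : ∀ r : R, y * e (Multiplicative.ofAdd r) * y⁻¹ = e (Multiplicative.ofAdd (u * r))) (k : ℕ) (r : R) :
    y ^ k * e (Multiplicative.ofAdd r) * (y ^ k)⁻¹ = e (Multiplicative.ofAdd (u ^ k * r)) := by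
  induction k generalizing r with
  | zero => simp
  | succ k ih =>
    rw [pow_succ', mul_inv_rev, pow_succ', show y * y ^ k * e (Multiplicative.ofAdd r) * ((y ^ k)⁻¹ * y⁻¹) =
      y * (y ^ k * e (Multiplicative.ofAdd r) * (y ^ k)⁻¹) * y⁻¹ by group, ih, hy, ← mul_assoc, mul_comm u (u ^ k)]

omit [NeZero n] hun in
/-- With `e` injective the twist scalar satisfies `u ^ orderOf y = 1`. [folklore] -/
theorem pow_orderOf_smul_eq (e : Multiplicative R →* G) (he : Function.Injective e) (y : G)
    (hy : ∀ r : R, y * e (Multiplicative.ofAdd r) * y⁻¹ = e (Multiplicative.ofAdd (u * r))) : u ^ orderOf y = 1 := by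
  have h := conj_pow_smul e y hy (orderOf y) 1
  rw [pow_orderOf_eq_one, one_mul, inv_one, mul_one] at h
  have := Multiplicative.ofAdd.injective (he h)
  rw [mul_one] at this
  exact this.symm

/-- **Universal property of `R ⋊_u ℤ/n`.** An additive character `e` of `R` in `G` and `y ∈ G` with `y^n = 1` twisting `e` by
`u` define the homomorphism `(r, t) ↦ e(r) · y^t`. [folklore] -/
def lift (e : Multiplicative R →* G) (y : G) (hyn : y ^ n = 1)
    (hy : ∀ r : R, y * e (Multiplicative.ofAdd r) * y⁻¹ = e (Multiplicative.ofAdd (u * r))) : RCyc R n u →* G where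
  toFun x := e (Multiplicative.ofAdd x.i) * y ^ x.t.val
  map_one' := by simp [one_def]
  map_mul' x z := by
    simp only [mul_def]
    rw [ZMod.val_add, pow_mod_eq_of_pow_eq_one hyn, pow_add, ofAdd_add, map_mul]
    have h := conj_pow_smul e y hy x.t.val z.i
    rw [mul_inv_eq_iff_eq_mul] at h
    calc e (Multiplicative.ofAdd x.i) * e (Multiplicative.ofAdd (act u x.t * z.i)) * (y ^ x.t.val * y ^ z.t.val)
        = e (Multiplicative.ofAdd x.i) * (y ^ x.t.val * e (Multiplicative.ofAdd z.i) * (y ^ x.t.val)⁻¹) *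
            (y ^ x.t.val * y ^ z.t.val) := by rw [conj_pow_smul e y hy]; rfl
      _ = e (Multiplicative.ofAdd x.i) * y ^ x.t.val * (e (Multiplicative.ofAdd z.i) * y ^ z.t.val) := by group

/-- Value of `lift`. [folklore] -/
theorem lift_apply (e : Multiplicative R →* G) (y : G) (hyn : y ^ n = 1)
    (hy : ∀ r : R, y * e (Multiplicative.ofAdd r) * y⁻¹ = e (Multiplicative.ofAdd (u * r))) (x : RCyc R n u) :
    lift e y hyn hy x = e (Multiplicative.ofAdd x.i) * y ^ x.t.val := rfl

/-- **Injectivity of `lift`**: if `e` is injective and `y^t ∈ e(R)` only for `t = 0`, then `lift` is injective. [folklore] -/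
theorem lift_injective (e : Multiplicative R →* G) (y : G) (hyn : y ^ n = 1)
    (hy : ∀ r : R, y * e (Multiplicative.ofAdd r) * y⁻¹ = e (Multiplicative.ofAdd (u * r)))
    (he : Function.Injective e) (hker : ∀ (t : ZMod n) (r : R), y ^ t.val = e (Multiplicative.ofAdd r) → t = 0) :
    Function.Injective (lift e y hyn hy) := by
  rw [injective_iff_map_eq_one]
  intro x hx
  rw [lift_apply] at hx
  have hyt : y ^ x.t.val = e (Multiplicative.ofAdd (-x.i)) := by
    rw [ofAdd_neg, map_inv]
    exact eq_inv_of_mul_eq_one_right hx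
  have ht : x.t = 0 := hker x.t (-x.i) hyt
  rw [ht, ZMod.val_zero, pow_zero, mul_one] at hx
  have hi : x.i = 0 := by
    have := he (hx.trans (map_one e).symm)
    simpa using this
  exact RCyc.ext hi ht

/-- **Reduction `R ⋊_u ℤ/n →* R ⋊_u ℤ/q`** for `q ∣ n` (`u^q = 1`): `(r, t) ↦ (r, t mod q)`. [folklore] -/
def redHom {q : ℕ} [NeZero q] [huq : Fact (u ^ q = 1)] (hqn : q ∣ n) : RCyc R n u →* RCyc R q u where
  toFun x := ⟨x.i, ZMod.castHom hqn (ZMod q) x.t⟩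
  map_one' := by ext <;> simp [one_def]
  map_mul' x z := by
    ext
    · simp only [mul_def]
      congr 1
      unfold act
      rw [ZMod.castHom_apply, ZMod.cast_eq_val, ZMod.val_natCast]
      conv_lhs => rw [← Nat.mod_add_div x.t.val q, pow_add, pow_mul, huq.out, one_pow, mul_one]
    · simp only [mul_def, map_add]

/-- The reduction is surjective. [folklore] -/
theorem redHom_surjective {q : ℕ} [NeZero q] [Fact (u ^ q = 1)] (hqn : q ∣ n) :
    Function.Surjective (redHom (R := R) (u := u) hqn) := by
  intro x
  obtain ⟨t, ht⟩ := ZMod.ringHom_surjective (ZMod.castHom hqn (ZMod q)) x.t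
  exact ⟨⟨x.i, t⟩, RCyc.ext rfl ht⟩

end RCyc

/-! ### Bridges from the concrete models -/

namespace MetaCyc

/-- **`MetaCyc N q u →* RCyc (ZMod N) q u`**, the identity on coordinates (the two types have the same multiplication). [folklore] -/
def toRCyc (N q : ℕ) (u : ZMod N) [NeZero q] [Fact (u ^ q = 1)] : MetaCyc N q u →* RCyc (ZMod N) q u where
  toFun x := ⟨x.i, x.t⟩
  map_one' := rfl
  map_mul' _ _ := rfl

/-- `toRCyc` is injective. [folklore] -/
theorem toRCyc_injective (N q : ℕ) (u : ZMod N) [NeZero q] [Fact (u ^ q = 1)] : Function.Injective (toRCyc N q u) := by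
  intro x y h
  have h1 := congrArg RCyc.i h
  have h2 := congrArg RCyc.t h
  exact MetaCyc.ext h1 h2

end MetaCyc

/-- `(-1)² = 1` in `ZMod m`, as a `Fact` (group law of `RCyc (ZMod m) 2 (-1)`). [folklore] -/
instance fact_neg_one_sq (m : ℕ) : Fact ((-1 : ZMod m) ^ 2 = 1) := ⟨by rw [neg_one_sq]⟩

namespace DihedralToRCyc

variable {m : ℕ}

/-- The map `D_{2m} → ℤ/m ⋊_{-1} ℤ/2`: `r i ↦ (i, 0)`, `sr i ↦ (−i, 1)`. [folklore] -/
def f : DihedralGroup m → RCyc (ZMod m) 2 (-1)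
  | DihedralGroup.r i => ⟨i, 0⟩
  | DihedralGroup.sr i => ⟨-i, 1⟩

/-- `(-1)^t` for `t : ZMod 2`. [folklore] -/
theorem act_neg_one (t : ZMod 2) : RCyc.act (-1 : ZMod m) t = if t = 0 then 1 else -1 := by
  unfold RCyc.act
  have ht : t = 0 ∨ t = 1 := by decide +revert
  rcases ht with rfl | rfl
  · simp
  · rw [if_neg (by decide), show (1 : ZMod 2).val = 1 from rfl, pow_one]

/-- `f` is multiplicative. [folklore] -/
theorem f_mul (x y : DihedralGroup m) : f (x * y) = f x * f y := by
  cases x with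
  | r i =>
    cases y with
    | r j => refine RCyc.ext ?_ ?_ <;> simp [f, DihedralGroup.r_mul_r, RCyc.mul_def, act_neg_one]
    | sr j =>
      refine RCyc.ext ?_ ?_ <;> simp [f, DihedralGroup.r_mul_sr, RCyc.mul_def, act_neg_one]; ring
  | sr i =>
    cases y with
    | r j =>
      refine RCyc.ext ?_ ?_ <;> simp [f, DihedralGroup.sr_mul_r, RCyc.mul_def, act_neg_one]; ring
    | sr j =>
      refine RCyc.ext ?_ ?_ <;> simp [f, DihedralGroup.sr_mul_sr, RCyc.mul_def, act_neg_one]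
      · ring
      · decide

end DihedralToRCyc

/-- **`DihedralGroup m →* RCyc (ZMod m) 2 (-1)`**, `r i ↦ (i, 0)`, `sr i ↦ (−i, 1)`. [folklore] -/
def DihedralGroup.toRCyc (m : ℕ) : DihedralGroup m →* RCyc (ZMod m) 2 (-1) where
  toFun := DihedralToRCyc.f
  map_one' := by rw [DihedralGroup.one_def]; rfl
  map_mul' := DihedralToRCyc.f_mul

/-- `DihedralGroup.toRCyc` is injective. [folklore] -/
theorem DihedralGroup.toRCyc_injective (m : ℕ) : Function.Injective (DihedralGroup.toRCyc m) := by
  intro x y h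
  change DihedralToRCyc.f x = DihedralToRCyc.f y at h
  cases x with
  | r i =>
    cases y with
    | r j => have := congrArg RCyc.i h; simp [DihedralToRCyc.f] at this; rw [this]
    | sr j => have := congrArg RCyc.t h; simp [DihedralToRCyc.f] at this
  | sr i =>
    cases y with
    | r j => have := congrArg RCyc.t h; simp [DihedralToRCyc.f] at this
    | sr j => have := congrArg RCyc.i h; simp [DihedralToRCyc.f] at this; rw [this]

end Summit.MatrixMultiplication.OmegaCensus
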